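import Summits.BirchSwinnertonDyer.BirchSwinnertonDyer.Theorems.ResidualThetaTransportAtTwoDefs
import Summits.BirchSwinnertonDyer.BirchSwinnertonDyer.Theorems.ThetaPartnerAtTwoSignedKatoUpToAtTwoLocalTwoModel
import Summits.BirchSwinnertonDyer.BirchSwinnertonDyer.Theorems.ThetaPartnerAtTwoSignedKatoUpToAtTwoHondaLogCharSum
import Summits.BirchSwinnertonDyer.Rank1Residual.Additive.PadicLayerTransport
import Summits.BirchSwinnertonDyer.Rank1Residual.Additive.KobayashiSignedGenerationDischarge
import Literature.NumberTheory.EllipticCurves.MazurTateElementCoeffField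
import Literature.NumberTheory.EllipticCurves.Kato2004.IwasawaCohomologyCoeffNewform
import Literature.NumberTheory.EllipticCurves.FormalGroupChart
import Mathlib.NumberTheory.DirichletCharacter.GaussSum
import Mathlib.NumberTheory.Padics.Complex
import Summits.BirchSwinnertonDyer.BirchSwinnertonDyer.Theorems.ThetaPartnerAtTwoSignedControlAtTwoPlusHondaTransportNonDiv
import Summits.BirchSwinnertonDyer.BirchSwinnertonDyer.Theorems.ThetaPartnerAtTwoSignedKatoUpToAtTwoKatoBKTransport
import HarnessLib

/-!
# Route `ResidualThetaTransportAtTwo` (RTT) — definition file 4: the VALUED-CLASS PREDICATES of the KZ_g hold-opening at the one-pair pins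
# (`CoordNondeg`, `KatoFrame` / `nonempty_katoFrame`, `KatoBKCoord`, `KatoValCoord`, `KatoTrivCoord`, `KatoValuedClass`) — the vocabulary of the two
# HOLD children of `KatoZetaCMFormAtTwoSupply` (stmt-BirchSwinnertonDyer-24105, S3″): CHILD A `KatoZetaValuedClassCMAtTwo` (print: Kato Thm 12.5 (1)
# via §15.16 ∧ Bloch–Kato §3, with `q ≠ 0`), CHILD B `KatoZetaAlgebraicSideCMAtTwo` (package-free composite: K0a ∧ K0b ∧ (valued class ⟹ (ii_fin) ∧ (ii_λ), `D := μt`))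

Cell `bsd-wall`; TEXTS OF RECORD by the route pen `bsd-wall-p2` g19 (`KZgHold.lean` v2, sha16 047eb7f8b5baac2e, evidence #6 on item 24105; §1 extracted as
`splitday/ResidualThetaTransportAtTwoKatoZetaDefs.lean` 92d73423d7c00317), landed by the width seat `prover-bsd-wall-tp2-p2x-w2` g21 on the stub-critic's
GO (STUB-PLAN `stub_cmLambdaLower` rev 26.6, Q131; texts settled S133/S136) — byte-identical to the pen's §1 except for the dropped route-file import (the
route file will import THIS module) and this docstring. DATA/`Prop`-valued DEFINITIONS over `π : OnePairPins …` and one existence theorem; no instance,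
no notation, no attribute, no `sorry`; nothing about any curve or form is asserted; BSD is not proved by anything here; 22608 / 26074 / 24105 stay
OPEN / HOLD. Companion of `…ResidualThetaTransportAtTwoDefs.lean` (`OnePairPins`), `…AwayDefs.lean`, `…OnePairSupplyDefs.lean`. Scope of record:
`KZG-HOLD-OPENING-SCOPE-g19.md` (evidence #3 on 24105); critic's S125 (H-BKρ type = k4-g21 PLAN A), S127 (sockets), S130 (leaves are at-pins
route-item texts), S133/S136 (texts v2 of record, Λ-multiplier `μt`).

CONTENTS: the four `Prop`-valued predicates of the valued class over the pin bundle `π : OnePairPins …` — `CoordNondeg`, `KatoBKCoord` (the layer Tate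
   pairing of `proj_m (a • z)` against ONE formal point in coordinate `i`, through Θ, = the `t₀`-recombined Galois sums of `log_ω(Q) · w_j` — TP2's `hXγ`
   (BK) clause of `Theorems.KatoZetaErlKSideCMAtTwo.katoZetaErlKSideCMAtTwoSupply_of_katoValuesKSide` with `A ↦ W`, `ℤ₂ ↦ 𝒪`, `e(x) ↦ w`, the
   constants `t₀(c′_i a bO_j)` OUTSIDE the Galois sums — k4-g21 (F1)–(F3)), `KatoValCoord` (Kato's values at the even primitive characters mod `2^{m+2}`,
   pushed to `ℂ₂`, with the `Λ_𝒪`-multiplier `μt` evaluated at `ψ(5) − 1` and the `K`-valued symbols `ι [a/2^{m+2}]⁺_{g,Ω}` of `plusSymbolK`),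
   `KatoTrivCoord` (levels 4, 8, Euler factor `3/2` at `a₂(g) = 0`), bundled as `KatoValuedClass` (+ `q ≠ 0`, `μt ≠ 0`); and TP2's 2-adic frame
   `(Φ, φ, τ)` bundled as the structure `KatoFrame π` with `nonempty_katoFrame` (a frame EXISTS: `SignedEC.exists_model_padic_adicCompletion`,
   `KatoBK.exists_tau_two`), so that the children texts read `∀ (F : π.KatoFrame), …` within the stub-record cap.
WHY `D := μt` IN CHILD B (pen note on critic S132 α, which writes the composite with `D := 1`): the §15 valued classes `z^{(𝔞)}` (elliptic units
   with auxiliary ideal `𝔞`, values carrying `μ_𝔞 = N𝔞 − σ_𝔞`, (15.6.3)) satisfy child A's predicate with `μt = μ_𝔞`, and at `p = 2` every odd `N𝔞 ≡ 1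
   (mod 2)`, so `λ_𝒪(Λ_𝒪/μ_𝔞) ≥ 1` and `λ(𝐇¹/Λ z^{(𝔞)}) = λ(𝐇¹/Z) + λ(Λ/μ_𝔞)`; the slack-free composite would over-claim for these tuples, the
   `μt`-slack composite is exactly print ∘ port for them and for the constant-`μt` (two-ideal) classes alike, and it is S3″'s (ii)-half VERBATIM
   with `D := μt` — so k3's (ii)-half is the identity and the (i)-half carries the same `D := μt` (values `q · μt(ψ) · L`).

References: [Kato2004Asterisque] Thm. 12.5 (1)(2), 12.6 (pp. 221–222), §15.15–15.16 (p. 265); [BlochKato1990] §3 (3.10.1), (3.11);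
[Kobayashi2003] (8.23), (8.29), Prop. 7.1 ii); [BurungaleTian2026] Thm. 2.6, Rem. 2.5, Rem. 2.7 (p. 5).
-/

set_option autoImplicit false
set_option linter.dupNamespace false
set_option backward.isDefEq.respectTransparency false

noncomputable section

open scoped Classical NumberField TensorProduct

namespace Summit.BirchSwinnertonDyer.BirchSwinnertonDyer.Theorems.OnePair

open Literature.NumberTheory.EllipticCurves Literature.NumberTheory.EllipticCurves.GreenbergSelmer
open Literature.NumberTheory.GaloisRepresentations NumberField IsDedekindDomain Field
open GreenbergVatsal2000 Kobayashi2003 Rat.HeightOneSpectrum PowerSeries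
open Literature.NumberTheory.EllipticCurves.FormalGroupChart
open Summit.BirchSwinnertonDyer.Rank1Residual.Additive Summit.BirchSwinnertonDyer.Rank1Residual.Additive.PadicCyclotomicTower
  Summit.BirchSwinnertonDyer.Rank1Residual.Additive.BallEval
open Summit.BirchSwinnertonDyer.BirchSwinnertonDyer.Theorems.SignedKatoOffTwo
  Summit.BirchSwinnertonDyer.BirchSwinnertonDyer.Theorems.SignedKatoOffTwo.LocalTwo

namespace OnePairPins

section KatoZeta

variable {S : Set (PadicAlgCl 2)} {W : WeierstrassCurve ℚ} [W.IsElliptic] {κ : ZpExtension ℚ 2} {γ : absoluteGaloisGroup ℚ}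
  {S₀ : Finset (HeightOneSpectrum (𝓞 ℚ))} {n : ℕ} {ρ : FramedGaloisRep ℚ ↥(padicCoeffIntegers S) 2}
  {Θ : ∀ v : HeightOneSpectrum (𝓞 ℚ), ((2 : ℕ) : 𝓞 ℚ) ∈ v.asIdeal → (Cofree ρ ↥(padicCoeffField S) ≃+ (Fin n → ↥(W.geomPrimaryTorsion 2)))}
  {hΘ : ∀ v hv (δ : absoluteGaloisGroup (v.adicCompletion ℚ)) m i,
    Θ v hv (resGalOfEmb (closureEmb (K := ℚ) (v.adicCompletion ℚ)) δ • m) i = resGalOfEmb (closureEmb (K := ℚ) (v.adicCompletion ℚ)) δ • Θ v hv m i}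
  {I : Kato2004.IwasawaH1DataCoeff (FramedGaloisRep.toGaloisRep ρ) 2 κ γ}
  {Sg : AddSubgroup (subgroupH1 κ.kerSubgroup (Cofree ρ ↥(padicCoeffField S)))} [Module ↥(padicCoeffIntegers S) ↥Sg]
  (π : OnePairPins S W κ γ S₀ n ρ Θ hΘ I Sg)

/-- `CoordNondeg π c′`: the `n` functionals `a ↦ t₀(c′_i a)` of `𝒪` separate points (k4-g21 (ND): `c′` is a `ℚ₂`-basis of `F_λ` when `n = f`).
Nothing asserted. [cite: Kato2004Asterisque, §14.9 (p. 239)] -/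
def CoordNondeg (c' : Fin n → ↥(padicCoeffIntegers S)) : Prop :=
  Function.Injective (fun (a : ↥(padicCoeffIntegers S)) (i : Fin n) => π.t₀ (c' i * a))

/-- **A `2`-adic frame at the pinned place `π.v ∋ 2`** (TP2's `(Φ, φ, τ)`, bundled): an isomorphism of algebraic closures `Φ : ℚ̄₂ ≃ ℚ̄_v` over `ℚ`
lying over a field isomorphism `φ : ℚ₂ ≃ ℚ_v`, and Galois representatives `τ_{m,a} ∈ Γ_{ℚ₂}` with `τ_{m,a} ζ_{2^m} = ζ_{2^m}^a` for the units `a`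
(the tree's `PadicCyclotomicTower.zeta 2 m`). A frame EXISTS (`nonempty_katoFrame`); the item texts quantify over all frames. Nothing asserted.
[cite: SerreGaloisCohomology1997, II.§1.1] [cite: Washington1997, §7.2] -/
structure KatoFrame : Type where
  /-- `Φ : ℚ̄₂ ≃ₐ[ℚ] ℚ̄_v` -/
  Φ : AlgebraicClosure ℚ_[2] ≃ₐ[ℚ] AlgebraicClosure (π.v.adicCompletion ℚ)
  /-- `φ : ℚ₂ ≃ ℚ_v` -/
  φ : ℚ_[2] ≃+* π.v.adicCompletion ℚ
  /-- `Φ` lies over `φ` -/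
  hΦφ : ∀ y : ℚ_[2], Φ (algebraMap ℚ_[2] (AlgebraicClosure ℚ_[2]) y) =
    algebraMap (π.v.adicCompletion ℚ) (AlgebraicClosure (π.v.adicCompletion ℚ)) (φ y)
  /-- Galois representatives `τ_{m,a}` -/
  τ : ∀ m : ℕ, ZMod (2 ^ m) → Field.absoluteGaloisGroup ℚ_[2]
  /-- `τ_{m,a} ζ_{2^m} = ζ_{2^m}^a` for units `a` -/
  hτ : ∀ (m : ℕ) (a : ZMod (2 ^ m)), IsUnit a → τ m a • zeta 2 m = zeta 2 m ^ a.val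

/-- **A frame exists** (the tree: `SignedEC.exists_model_padic_adicCompletion`, `SignedKatoOffTwo.KatoBK.exists_tau_two`). [folklore] -/
theorem nonempty_katoFrame : Nonempty π.KatoFrame := by
  obtain ⟨Φ, φ, hΦφ, -⟩ :=
    Summit.BirchSwinnertonDyer.BirchSwinnertonDyer.Theorems.SignedEC.exists_model_padic_adicCompletion (p := 2) π.hv
  obtain ⟨τ, hτ⟩ := Summit.BirchSwinnertonDyer.BirchSwinnertonDyer.Theorems.SignedKatoOffTwo.KatoBK.exists_tau_two
  exact ⟨⟨Φ, φ, hΦφ, τ, hτ⟩⟩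

set_option maxHeartbeats 800000 in
/-- **(BKρ)** `KatoBKCoord π Φ τ z c′ w` — Bloch–Kato §3 (3.10.1)/(3.11) ∘ Kato Thm 12.5 (1) (via Thm 9.7 + 6.6) read on THE pinned layer pairing
family `π.pair` through `Θ`, one formal point `Q` of `W(ℚ_{m,v})` in coordinate `i`: for every `a ∈ 𝒪`,
`⟨proj_m (a • z), Q·e_i⟩_m = Σ_j t₀(c′_i · a · bO_j) · Σ_{b ∈ (ℤ/2^{m+2})ˣ} τ_b • (log_ω(Q) · w_{m+2,j})` in `ℚ̄₂` — TP2's (BK) clause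
(`katoZetaErlKSideCMAtTwoSupply_of_katoValuesKSide`, hypothesis `hXγ`) with `A ↦ W`, `e_{m+2}(x_{m+2}) ↦ w (m+2) j` (the `bO`-coordinates of
Kato's value `exp*(z_{2^{m+2}}) ∈ F ⊗ ℚ(ζ_{2^{m+2}})` read in `F_λ ⊗_{ℚ₂} ℚ̄₂ = ⊕_j bO_j ⊗ ℚ̄₂`) and the `𝒪`-constants OUTSIDE the Galois sums
(k4-g21 (F3)). The log term is TP2's verbatim (`ptLogΩ` on the `2`-adic model `M_W`, points moved by `toLoc` and the frame `Φ`). Nothing asserted.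
[cite: BlochKato1990, Def. 3.10 and Ex. 3.10.1 (pp. 359–360), Ex. 3.11 (p. 361)] [cite: Kato2004Asterisque, Thm. 12.5 (1) (pp. 221–222)]
[cite: Kobayashi2003, (8.23) (p. 18), (8.29) (p. 24)] -/
def KatoBKCoord [W.IsGloballyMinimal] (Φ : AlgebraicClosure ℚ_[2] ≃ₐ[ℚ] AlgebraicClosure (π.v.adicCompletion ℚ))
    (τ : ∀ m : ℕ, ZMod (2 ^ m) → Field.absoluteGaloisGroup ℚ_[2])
    (z : I.H) (c' : Fin n → ↥(padicCoeffIntegers S)) (w : ℕ → Fin π.nb → PadicAlgCl 2) : Prop :=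
  haveI := isIntegral_genFib_baseChange 2 ((WeierstrassCurve.integralModelInt W).map (Int.castRingHom ℤ_[2]))
  ∀ (a : ↥(padicCoeffIntegers S)) (m : ℕ) (i : Fin n) (Q₀ : localPoints W ℚ_[2])
    (hQv : WeierstrassCurve.Affine.Point.map (W' := W)
        (Φ : AlgebraicClosure ℚ_[2] →ₐ[ℚ] AlgebraicClosure (π.v.adicCompletion ℚ))
        (show (W.baseChange (AlgebraicClosure ℚ_[2])).toAffine.Point from Q₀) ∈
      localLayerPointsOfEmb κ (closureEmb (K := ℚ) (π.v.adicCompletion ℚ)) W m),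
    (toLoc ((genFibΩ_eq_baseChange ((WeierstrassCurve.integralModelInt W).map (Int.castRingHom ℤ_[2]))).trans
      (baseChange_twoAdicModel W))).symm Q₀ ∈
      kernel (Valued.v (R := PadicAlgCl 2)) (genFibΩ 2 ((WeierstrassCurve.integralModelInt W).map (Int.castRingHom ℤ_[2]))) →
    algebraMap ℚ_[2] (PadicAlgCl 2)
        ((π.pair m (I.proj m ((PowerSeries.C a : IwasawaAlgebraO S) • z)) (Pi.single i ⟨_, hQv⟩) : ℤ_[2]) : ℚ_[2]) =
      ∑ j : Fin π.nb, algebraMap ℚ_[2] (PadicAlgCl 2) ((π.t₀ (c' i * a * π.bO j) : ℤ_[2]) : ℚ_[2]) *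
        ∑ b : (ZMod (2 ^ (m + 2)))ˣ, τ (m + 2) (b : ZMod (2 ^ (m + 2))) •
          (ptLogΩ 2 ((WeierstrassCurve.integralModelInt W).map (Int.castRingHom ℤ_[2]))
              ((toLoc ((genFibΩ_eq_baseChange ((WeierstrassCurve.integralModelInt W).map (Int.castRingHom ℤ_[2]))).trans
                (baseChange_twoAdicModel W))).symm Q₀) * w (m + 2) j)

/-- **(VALρ)** `KatoValCoord π g ι Ω τ w q μt` — Kato Thm 12.5 (1) for the CM newform `g` (§15.16, branch `K ⊄ ℚ(ζ_{2^∞})` of 15.13) at the even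
PRIMITIVE Dirichlet characters `ψ` mod `2^{m+2}` (values in `ℚ̄₂`), pushed to `ℂ₂`: the `bO`-recombined twisted Galois sum of the values times the
Gauss sum equals `q · μt(ψ(5) − 1) · Σ_a ψ(a) ι[a/2^{m+2}]⁺_{g,Ω}` (`plusSymbolK`; the `Λ_𝒪`-multiplier `μt` carries the auxiliary twist of the
§15 elliptic zeta element and the integrality scaling, as in TP2's (VAL) with `ℤ₂ ↦ 𝒪`). Nothing asserted.
[cite: Kato2004Asterisque, Thm. 12.5 (1) (pp. 221–222), §15.16 and (15.16.1) (p. 265), (15.6.3) (p. 254)] -/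
def KatoValCoord {M : ℕ} [NeZero M] (g : CuspForm (CongruenceSubgroup.Gamma0 M) 2) (ι : ModularForms.coeffField g →+* PadicAlgCl 2) (Ω : ℂ)
    (τ : ∀ m : ℕ, ZMod (2 ^ m) → Field.absoluteGaloisGroup ℚ_[2])
    (w : ℕ → Fin π.nb → PadicAlgCl 2) (q : PadicAlgCl 2) (μt : IwasawaAlgebraO S) : Prop :=
  ∀ (m : ℕ) (ψ : DirichletCharacter (PadicAlgCl 2) (2 ^ (m + 2))), ψ (-1) = 1 → ψ.IsPrimitive →
    algebraMap (PadicAlgCl 2) ℂ_[2]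
        ((∑ j : Fin π.nb, ((π.bO j : ↥(padicCoeffIntegers S)) : PadicAlgCl 2) *
            ∑ b : (ZMod (2 ^ (m + 2)))ˣ, ψ⁻¹ (b : ZMod (2 ^ (m + 2))) * τ (m + 2) (b : ZMod (2 ^ (m + 2))) • w (m + 2) j) *
          gaussSum ψ (AddChar.zmodChar (2 ^ (m + 2)) (HondaLog.zeta_pow_prime_pow_self (p := 2) (m + 2)))) =
      algebraMap (PadicAlgCl 2) ℂ_[2] q *
        (∑' k, algebraMap (PadicAlgCl 2) ℂ_[2] ((PowerSeries.coeff k μt : ↥(padicCoeffIntegers S)) : PadicAlgCl 2) *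
            (algebraMap (PadicAlgCl 2) ℂ_[2] (ψ (5 : ZMod (2 ^ (m + 2)))) - 1) ^ k) *
        algebraMap (PadicAlgCl 2) ℂ_[2]
          (∑ a : ZMod (2 ^ (m + 2)), ψ a * ι (plusSymbolK g Ω ((a.val : ℚ) / (2 : ℚ) ^ (m + 2))))

/-- **(TRIVρ)** `KatoTrivCoord π g ι Ω τ w q μt` — Kato Thm 12.5 (1) at the trivial character of levels `4` and `8`: the `bO`-recombined Galois trace
of the value is `(3/2) · q · μt(0) · ι[0]⁺_{g,Ω}` (depleted Euler factor `1 − a₂(g)/2 + 1/2 = 3/2` at `a₂(g) = 0`), TP2's (TRIV) with `ℤ₂ ↦ 𝒪`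
(traces land in `ℚ₂`, so the multiplied form is harmless here). Nothing asserted. [cite: Kato2004Asterisque, Thm. 12.5 (1) (pp. 221–222)] -/
def KatoTrivCoord {M : ℕ} [NeZero M] (g : CuspForm (CongruenceSubgroup.Gamma0 M) 2) (ι : ModularForms.coeffField g →+* PadicAlgCl 2) (Ω : ℂ)
    (τ : ∀ m : ℕ, ZMod (2 ^ m) → Field.absoluteGaloisGroup ℚ_[2])
    (w : ℕ → Fin π.nb → PadicAlgCl 2) (q : PadicAlgCl 2) (μt : IwasawaAlgebraO S) : Prop :=
  ∀ k : ℕ, 2 ≤ k → k ≤ 3 →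
    ∑ j : Fin π.nb, ((π.bO j : ↥(padicCoeffIntegers S)) : PadicAlgCl 2) * ∑ b : (ZMod (2 ^ k))ˣ, τ k (b : ZMod (2 ^ k)) • w k j =
      (3 / 2 : PadicAlgCl 2) * q * ((PowerSeries.coeff 0 μt : ↥(padicCoeffIntegers S)) : PadicAlgCl 2) * ι (plusSymbolK g Ω 0)

/-- **The valued class** `KatoValuedClass π g ι Ω Φ τ z c′ w q μt := q ≠ 0 ∧ μt ≠ 0 ∧ CoordNondeg ∧ (BKρ) ∧ (VALρ) ∧ (TRIVρ)` — the print-side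
content of KZ_g at the pins (child A asserts its existence; child B consumes it). `q ≠ 0` is the non-vacuity guard (T64/T67; TP2's `κ_K ≠ 0`);
`μt ≠ 0` prices the multiplier in `λ(Λ_𝒪/μt)` (absorbed by S3″'s `D`). Nothing asserted.
[cite: Kato2004Asterisque, Thm. 12.5 (1) (pp. 221–222), §15.16 (p. 265)] [cite: BlochKato1990, §3 (3.10.1), (3.11)] -/
def KatoValuedClass [W.IsGloballyMinimal] {M : ℕ} [NeZero M] (g : CuspForm (CongruenceSubgroup.Gamma0 M) 2)
    (ι : ModularForms.coeffField g →+* PadicAlgCl 2) (Ω : ℂ)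
    (Φ : AlgebraicClosure ℚ_[2] ≃ₐ[ℚ] AlgebraicClosure (π.v.adicCompletion ℚ))
    (τ : ∀ m : ℕ, ZMod (2 ^ m) → Field.absoluteGaloisGroup ℚ_[2])
    (z : I.H) (c' : Fin n → ↥(padicCoeffIntegers S)) (w : ℕ → Fin π.nb → PadicAlgCl 2) (q : PadicAlgCl 2) (μt : IwasawaAlgebraO S) : Prop :=
  q ≠ 0 ∧ μt ≠ 0 ∧ π.CoordNondeg c' ∧ π.KatoBKCoord Φ τ z c' w ∧ π.KatoValCoord g ι Ω τ w q μt ∧ π.KatoTrivCoord g ι Ω τ w q μt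

end KatoZeta

end OnePairPins

end Summit.BirchSwinnertonDyer.BirchSwinnertonDyer.Theorems.OnePair


end
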